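import Summits.ValiantsHypothesis.ValiantsHypothesis.Theorems.KPlusLogSqLawTropicalBHessenberg
import Summits.ValiantsHypothesis.ValiantsHypothesis.Theorems.KPlusLogSqLawTropicalBShadowCap

/-!
# Route «KPlusLogSqLaw», crux `TropicalB` (stmt-ValiantsHypothesis-19771) — the SQUARE-TOWER rung and the two regime stubs
# ON THE HESSENBERG SECTOR

HONEST FRAMING.  Corollaries of the Hessenberg sector theorem `IntervalOpt.designRowD_hessenberg` (Gusfield's divide and conquer,
`KPlusLogSqLawTropicalBHessenberg.lean`) toward the registered stubs `stub_tropThin` / `stub_tropFat` of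
`Cruxes/TropicalB/Lines/birth.lean` and the plan-only square-tower rung `∃ C, ∀ K, TropRow (K^2) K (2^(C·K))` (seat val-sym-trop-p5,
desk docket «square tower» / D1a).  SECTOR statements only (designs with `IsHessenberg ε`, i.e. DAG-path supports); nothing is
claimed for general supports; nothing here bears on `MatrixDescartes` (stmt-ValiantsHypothesis-18050) or VP ≠ VNP.

* `designRowD_hessenberg_squareTower` — on the square tower `m = K²` every Hessenberg design has unsigned row bound `2^{C K}` with an
  absolute `C` (`= 30·(A'+2)`, `A'` the constant of `exists_logsq_sq_le_add`): the square-tower rung holds on the path sector.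
* `designRowD_hessenberg_thin` / `designRowD_hessenberg_fat` — the two regime stubs' conclusions (`2^{C ⌊log₂ m⌋²}` for
  `K ≤ ⌊log₂ m⌋²`, `2^{C K}` for `⌊log₂ m⌋² ≤ K`) on the Hessenberg sector, `C = 60`.
[folklore: Gusfield 1980 + arithmetic]
-/

set_option linter.dupNamespace false
set_option autoImplicit false

namespace Summit.ValiantsHypothesis.ValiantsHypothesis.Theorems.KPlusLogSqLaw

open Summit.ValiantsHypothesis.ValiantsHypothesis.Theorems.MatrixDescartes.Negative
open Summit.ValiantsHypothesis.ValiantsHypothesis.Theorems.LacunarySymmetroidMatrixDescartes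

namespace IntervalOpt

variable {m K : ℕ}

/-- **The square-tower rung on the Hessenberg sector**: an absolute `C` with `DesignRowD d v ε (2^{C K})` for every Hessenberg
design of format `(K², K)`. [folklore] -/
theorem designRowD_hessenberg_squareTower : ∃ C : ℕ, ∀ (K : ℕ) (d : Fin K → ℕ)
    (v ε : Fin (K ^ 2) → Fin (K ^ 2) → Fin K → ℤ), IsHessenberg ε → DesignRowD d v ε (2 ^ (C * K)) := by
  obtain ⟨A', hA'⟩ := exists_logsq_sq_le_add
  refine ⟨30 * (A' + 2), fun K d v ε hH => ?_⟩
  rcases Nat.eq_zero_or_pos K with hK | hK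
  · -- no classes: the unsigned row holds with every bound
    subst hK
    exact designRowD_of_tropRowD (tropRowD_zero _ _) d v ε
  · refine designRowD_mono (Nat.pow_le_pow_right (by norm_num) ?_) (designRowD_hessenberg d v ε hH)
    have h1 := hA' K
    calc 30 * (K + Nat.log 2 (K ^ 2) ^ 2) ≤ 30 * (K + (K + A')) := Nat.mul_le_mul_left _ (by omega)
      _ ≤ 30 * ((A' + 2) * K) := Nat.mul_le_mul_left _ (by nlinarith)
      _ = 30 * (A' + 2) * K := by ring

/-- the THIN stub's conclusion on the Hessenberg sector: `K ≤ ⌊log₂ m⌋² ⇒` unsigned row bound `2^{60 ⌊log₂ m⌋²}`. [folklore] -/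
theorem designRowD_hessenberg_thin (d : Fin K → ℕ) (v ε : Fin m → Fin m → Fin K → ℤ) (hH : IsHessenberg ε)
    (hK : K ≤ Nat.log 2 m ^ 2) : DesignRowD d v ε (2 ^ (60 * Nat.log 2 m ^ 2)) := by
  refine designRowD_mono (Nat.pow_le_pow_right (by norm_num) ?_) (designRowD_hessenberg d v ε hH)
  nlinarith

/-- the FAT stub's conclusion on the Hessenberg sector: `⌊log₂ m⌋² ≤ K ⇒` unsigned row bound `2^{60 K}`. [folklore] -/
theorem designRowD_hessenberg_fat (d : Fin K → ℕ) (v ε : Fin m → Fin m → Fin K → ℤ) (hH : IsHessenberg ε)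
    (hK : Nat.log 2 m ^ 2 ≤ K) : DesignRowD d v ε (2 ^ (60 * K)) := by
  refine designRowD_mono (Nat.pow_le_pow_right (by norm_num) ?_) (designRowD_hessenberg d v ε hH)
  nlinarith

end IntervalOpt

end Summit.ValiantsHypothesis.ValiantsHypothesis.Theorems.KPlusLogSqLaw
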